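import Mathlib
import HarnessLib
import Summits.Ventures.LatticeQCDFlow.Scoring.AllPairsAcceptanceRatioCeilingFree
import Summits.Ventures.LatticeQCDFlow.Scoring.SelfNormalisedReweightingHeavyTail

/-!
# The PRINTED acceptance ratio with NO second weight moment: the median over `R` blocks of
# `Û_r/W̄_r` is within `(t + u)/(1 − u)` of `acc(p, q)` with probability `≥ 1 − e^{−R/8}` as soon
# as `E_q w^{1+ε} = ∫ p^{1+ε}/q^ε dμ < ∞` for some `0 < ε ≤ 1` — even when `ESS = 0`

HONEST FRAMING: exact (Metropolis-corrected) sampling algorithms for lattice gauge theory;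
figures of merit are autocorrelation/cost numbers at stated couplings and volumes; no
continuum-physics claim.

Venture `LatticeQCDFlow` (cell pub-lqcd), topic `Scoring`; FANOUT row 4 (`s0-u1-b`, rung S0-B).
Row 4's `Scoring/AllPairsAcceptanceRatioCeilingFree` certifies the printed scale-free block ratio
`R_r = Û_r/W̄_r` (all-pairs mean of `min(w̃ᵢ, w̃ⱼ)` over the mean weight, unnormalised
`w̃ = c·p/q`) with the effective sample size `M₂ = 1/ESS` as the only analytic input — it enters
ONLY through Chebyshev for the block mean weight `W̄_r`; the all-pairs numerator needs nothing
(row 3's envelope `E_m(acc) ≤ 1/(m − 1)`, `Scoring/BlockStatisticsCeilingFree`).  Replacing that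
one Chebyshev step by the `(1 + ε)`-th-moment truncation bound for the mean weight
(`ReweightingMedian.meanWeight_heavyTail_iid`, previous file) removes `M₂` altogether: the
acceptance column is certified from the printed ratios whenever `A₁ = E_q w^{1+ε} =
∫ p^{1+ε}/q^ε dμ < ∞` for some `0 < ε ≤ 1`.  This completes the MOMENT LADDER of the ceiling-free
card read from ONE proposal stream: acceptance ratio and bounded observables — a `(1 + ε)`-th
weight moment (`Scoring/SelfNormalisedReweightingHeavyTail`); ESS — a `(2 + 2ε)`-th weight moment
(`Scoring/KishESSHeavyTail`); with normalised weights the all-pairs acceptance estimate itself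
needs no moment at all (`Scoring/AllPairsAcceptanceCeilingFree`).  NEW WORK of the cell
(elementary); no definition; nothing cited as a fact.

## Content (`ν = μ.withDensity q`; `w = p/q`; `A₁ = ∫ p^{1+ε}/q^ε dμ`;
## `acc = ∫∫ min(p(a)q(b), p(b)q(a)) dμ dμ`; `E_m(a) = (2(1 − a²) + 4(m − 2)(a − a²))/(m(m − 1))`)

* **`printedAcceptance_medianOfBlocks_confidence_heavyTail`** — `n` independent model draws,
  blocks of `m ≥ 2`, `R·m ≤ n`, `t > 0`, `0 < u < 1`, `8E_m(acc) ≤ t²`, `40A₁ ≤ m^ε u^{1+ε}`: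
  `P(#{r < R : (t + u)/(1 − u) ≤ |R_r − acc|} ≥ R/2) ≤ exp(−R/8)`.
* **`printedAcceptance_sampleMedian_confidence_heavyTail`** — ANY sample-median selection
  `med(ω)` with the a-priori radius `8/(m − 1) ≤ t²`: `P((t + u)/(1 − u) ≤ |med − acc|) ≤ e^{−R/8}`.

NOT CLAIMED: estimating `A₁` (an input); `ε = 0`; the realised acceptance of the chain
(`Scoring/IMHAcceptanceRecordConcentration`, flow lane); optimal constants; any number of ours
re-scored.
-/

noncomputable section

namespace Summit.Ventures.LatticeQCDFlow.Scoring.AllPairsMedian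

open MeasureTheory ProbabilityTheory Finset Real Set
open Summit.Ventures.LatticeQCDFlow.Scoring.BlockMedian
open Summit.Ventures.LatticeQCDFlow.Scoring.ReweightingMedian

section Certificate

variable {Ω : Type*} [MeasurableSpace Ω] {P : Measure Ω} [IsProbabilityMeasure P]
variable {X : Type*} [MeasurableSpace X] {μ : Measure X} [SFinite μ] {ε : ℝ} {n m R : ℕ}

set_option maxHeartbeats 400000 in
/-- **THE PRINTED ACCEPTANCE RATIO WITH NO SECOND WEIGHT MOMENT (oracle envelope).**  `n`
independent model draws `y_j` (laws `μ.withDensity q`); target `p ≥ 0` measurable, `∫ p = 1`,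
with `p^{1+ε}/q^ε ∈ L¹(μ)` (`A₁`) for some `0 < ε ≤ 1`; model `q > 0` measurable, integrable;
weights printed with ANY normalisation `w̃ = c·p/q`, `c > 0`; blocks of `m ≥ 2`, `R·m ≤ n`;
`t > 0`, `0 < u < 1` with `8E_m(acc) ≤ t²` and `40A₁ ≤ m^ε u^{1+ε}`.  Then
`P( #{r < R : (t + u)/(1 − u) ≤ |R_r − acc(p, q)|} ≥ R/2 ) ≤ exp(−R/8)`. [ours] -/
theorem printedAcceptance_medianOfBlocks_confidence_heavyTail {y : Fin n → Ω → X}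
    (hym : ∀ j, Measurable (y j)) (hind : iIndepFun y P) {p q : X → ℝ} (hp0 : ∀ z, 0 ≤ p z)
    (hpm : Measurable p) (hpi : Integrable p μ) (hp1 : ∫ z, p z ∂μ = 1) (hq0 : ∀ z, 0 < q z)
    (hqm : Measurable q) (hqi : Integrable q μ) (hε0 : 0 < ε) (hε1 : ε ≤ 1)
    (hA1i : Integrable (fun z => p z ^ (1 + ε) / q z ^ ε) μ)
    (hlaw : ∀ j, Measure.map (y j) P = μ.withDensity fun z => ENNReal.ofReal (q z))
    {wt : X → ℝ} {c : ℝ} (hc : 0 < c) (hwt : ∀ z, wt z = c * (p z / q z))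
    (hm : 2 ≤ m) (hRm : R * m ≤ n) {t u : ℝ} (ht : 0 < t) (hu : 0 < u) (hu1 : u < 1)
    (hvt : 8 * ((2 * (1 - (∫ a, ∫ b, min (p a * q b) (p b * q a) ∂μ ∂μ) ^ 2)
        + 4 * (m - 2) * ((∫ a, ∫ b, min (p a * q b) (p b * q a) ∂μ ∂μ)
          - (∫ a, ∫ b, min (p a * q b) (p b * q a) ∂μ ∂μ) ^ 2)) / (m * (m - 1))) ≤ t ^ 2)
    (hvu : 40 * ∫ z, p z ^ (1 + ε) / q z ^ ε ∂μ ≤ (m : ℝ) ^ ε * u ^ (1 + ε)) :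
    P.real {ω | (R : ℝ) / 2 ≤ #{r ∈ (univ : Finset (Fin R)) | (t + u) / (1 - u) ≤
        |((∑ z ∈ (univ : Finset (Fin m)).offDiag,
              min (wt (y ⟨((r : Fin R) : ℕ) * m + z.1, mul_add_lt hRm r z.1⟩ ω))
                (wt (y ⟨((r : Fin R) : ℕ) * m + z.2, mul_add_lt hRm r z.2⟩ ω)))
              / (m * (m - 1) : ℝ))
            / ((∑ j : Fin m, wt (y ⟨((r : Fin R) : ℕ) * m + j, mul_add_lt hRm r j⟩ ω)) / m)
          - ∫ a, ∫ b, min (p a * q b) (p b * q a) ∂μ ∂μ|}}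
      ≤ exp (-(R / 8)) := by
  rcases Nat.eq_zero_or_pos R with hR | hR
  · subst hR
    refine measureReal_le_one.trans ?_
    simp
  have hn : 0 < n := by
    have : 0 < m := by omega
    have : 0 < R * m := Nat.mul_pos hR this
    omega
  haveI hν : IsProbabilityMeasure (μ.withDensity fun z => ENNReal.ofReal (q z)) :=
    isProbabilityMeasure_of_map_eq_iid (hym ⟨0, hn⟩) (hlaw ⟨0, hn⟩)
  obtain ⟨ha0, ha1⟩ := AllPairsVariance.meanAccept_mem_Icc (μ := μ) hp0 hpm hpi hp1 hq0 hqm hqi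
  have hwtm : Measurable wt := by
    have : wt = fun z => c * (p z / q z) := funext hwt
    rw [this]
    exact (hpm.div hqm).const_mul c
  -- the printed block ratio as a measurable function of the block
  have hg : Measurable fun (v : Fin m → X) =>
      ((∑ z ∈ (univ : Finset (Fin m)).offDiag, min (wt (v z.1)) (wt (v z.2))) / (m * (m - 1) : ℝ))
        / ((∑ j : Fin m, wt (v j)) / m) := by
    refine Measurable.div (Measurable.div_const (Finset.measurable_sum _
      fun (z : Fin m × Fin m) _ => ?_) _) (Measurable.div_const (Finset.measurable_sum _
      fun (j : Fin m) _ => hwtm.comp (measurable_pi_apply j)) _)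
    exact (hwtm.comp (measurable_pi_apply z.1)).min (hwtm.comp (measurable_pi_apply z.2))
  have h2 : (2 : ℝ) ≤ m := by exact_mod_cast hm
  have hm0 : (0 : ℝ) < m := by linarith
  have hDu : 0 < (m : ℝ) ^ ε * u ^ (1 + ε) :=
    mul_pos (Real.rpow_pos_of_pos hm0 _) (Real.rpow_pos_of_pos hu _)
  -- each block is bad with probability ≤ 1/8 + 1/8
  have hfar : ∀ r ∈ (univ : Finset (Fin R)), P.real {ω | (t + u) / (1 - u) ≤
      |((∑ z ∈ (univ : Finset (Fin m)).offDiag,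
            min (wt (y ⟨(r : ℕ) * m + z.1, mul_add_lt hRm r z.1⟩ ω))
              (wt (y ⟨(r : ℕ) * m + z.2, mul_add_lt hRm r z.2⟩ ω))) / (m * (m - 1) : ℝ))
          / ((∑ j : Fin m, wt (y ⟨(r : ℕ) * m + j, mul_add_lt hRm r j⟩ ω)) / m)
        - ∫ a, ∫ b, min (p a * q b) (p b * q a) ∂μ ∂μ|} ≤ 1 / 4 := by
    intro r _
    have hU := blockAllPairs_chebyshev hym hind hp0 hpm hpi hp1 hq0 hqm hqi hlaw hm hRm r ht
    have hW := meanWeight_heavyTail_iid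
      (x := fun (i : Fin m) => y ⟨(r : ℕ) * m + i, mul_add_lt hRm r i⟩) (fun i => hym _)
      (iIndepFun_block hind hRm r) hp0 hpm hpi hp1 hq0 hqm hε0 hε1 hA1i (fun i => hlaw _)
      (by omega) hu
    have hratio : ∀ ω,
        ((∑ z ∈ (univ : Finset (Fin m)).offDiag,
            min (wt (y ⟨(r : ℕ) * m + z.1, mul_add_lt hRm r z.1⟩ ω))
              (wt (y ⟨(r : ℕ) * m + z.2, mul_add_lt hRm r z.2⟩ ω))) / (m * (m - 1) : ℝ))
          / ((∑ j : Fin m, wt (y ⟨(r : ℕ) * m + j, mul_add_lt hRm r j⟩ ω)) / m)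
        = ((∑ z ∈ (univ : Finset (Fin m)).offDiag,
              min (p (y ⟨(r : ℕ) * m + z.1, mul_add_lt hRm r z.1⟩ ω)
                    / q (y ⟨(r : ℕ) * m + z.1, mul_add_lt hRm r z.1⟩ ω))
                  (p (y ⟨(r : ℕ) * m + z.2, mul_add_lt hRm r z.2⟩ ω)
                    / q (y ⟨(r : ℕ) * m + z.2, mul_add_lt hRm r z.2⟩ ω)))
              / (m * (m - 1) : ℝ))
            / ((∑ j : Fin m, p (y ⟨(r : ℕ) * m + j, mul_add_lt hRm r j⟩ ω)
                / q (y ⟨(r : ℕ) * m + j, mul_add_lt hRm r j⟩ ω)) / m) :=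
      fun ω => blockRatio_scale_free hc hwt fun i => y ⟨(r : ℕ) * m + i, mul_add_lt hRm r i⟩ ω
    have hsub : {ω | (t + u) / (1 - u) ≤
          |((∑ z ∈ (univ : Finset (Fin m)).offDiag,
                min (wt (y ⟨(r : ℕ) * m + z.1, mul_add_lt hRm r z.1⟩ ω))
                  (wt (y ⟨(r : ℕ) * m + z.2, mul_add_lt hRm r z.2⟩ ω))) / (m * (m - 1) : ℝ))
              / ((∑ j : Fin m, wt (y ⟨(r : ℕ) * m + j, mul_add_lt hRm r j⟩ ω)) / m)
            - ∫ a, ∫ b, min (p a * q b) (p b * q a) ∂μ ∂μ|}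
        ⊆ {ω | t ≤ |(∑ z ∈ (univ : Finset (Fin m)).offDiag,
              min (p (y ⟨(r : ℕ) * m + z.1, mul_add_lt hRm r z.1⟩ ω)
                    / q (y ⟨(r : ℕ) * m + z.1, mul_add_lt hRm r z.1⟩ ω))
                  (p (y ⟨(r : ℕ) * m + z.2, mul_add_lt hRm r z.2⟩ ω)
                    / q (y ⟨(r : ℕ) * m + z.2, mul_add_lt hRm r z.2⟩ ω)))
              / (m * (m - 1)) - ∫ a, ∫ b, min (p a * q b) (p b * q a) ∂μ ∂μ|}
          ∪ {ω | u ≤ |(∑ j : Fin m, p (y ⟨(r : ℕ) * m + j, mul_add_lt hRm r j⟩ ω)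
              / q (y ⟨(r : ℕ) * m + j, mul_add_lt hRm r j⟩ ω)) / m - 1|} := by
      intro ω hω
      simp only [mem_setOf_eq, mem_union] at hω ⊢
      rw [hratio ω] at hω
      by_contra hcon
      simp only [not_or, not_le] at hcon
      have key := abs_div_sub_lt_of_abs_sub_lt ha0 ha1 hu1 hcon.1 hcon.2
      linarith
    have hU' : (2 * (1 - (∫ a, ∫ b, min (p a * q b) (p b * q a) ∂μ ∂μ) ^ 2)
          + 4 * (m - 2) * ((∫ a, ∫ b, min (p a * q b) (p b * q a) ∂μ ∂μ)
            - (∫ a, ∫ b, min (p a * q b) (p b * q a) ∂μ ∂μ) ^ 2)) / (m * (m - 1)) / t ^ 2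
        ≤ 1 / 8 := by
      rw [div_le_iff₀ (pow_pos ht 2)]
      linarith
    have hW' : 5 * (∫ z, p z ^ (1 + ε) / q z ^ ε ∂μ) / ((m : ℝ) ^ ε * u ^ (1 + ε)) ≤ 1 / 8 := by
      rw [div_le_iff₀ hDu]
      linarith
    calc P.real _ ≤ P.real _ := measureReal_mono hsub
      _ ≤ _ := measureReal_union_le _ _
      _ ≤ 1 / 8 + 1 / 8 := add_le_add (hU.trans hU') (hW.trans hW')
      _ = 1 / 4 := by norm_num
  -- the printed block ratios are independent across blocks and measurable
  have hYind : iIndepFun (fun (r : Fin R) ω =>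
      ((∑ z ∈ (univ : Finset (Fin m)).offDiag,
          min (wt (y ⟨(r : ℕ) * m + z.1, mul_add_lt hRm r z.1⟩ ω))
            (wt (y ⟨(r : ℕ) * m + z.2, mul_add_lt hRm r z.2⟩ ω))) / (m * (m - 1) : ℝ))
        / ((∑ j : Fin m, wt (y ⟨(r : ℕ) * m + j, mul_add_lt hRm r j⟩ ω)) / m)) P :=
    iIndepFun_blockFun hym hind hRm hg
  have hYm : ∀ r : Fin R, Measurable fun ω =>
      ((∑ z ∈ (univ : Finset (Fin m)).offDiag,
          min (wt (y ⟨(r : ℕ) * m + z.1, mul_add_lt hRm r z.1⟩ ω))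
            (wt (y ⟨(r : ℕ) * m + z.2, mul_add_lt hRm r z.2⟩ ω))) / (m * (m - 1) : ℝ))
        / ((∑ j : Fin m, wt (y ⟨(r : ℕ) * m + j, mul_add_lt hRm r j⟩ ω)) / m) := fun r => by
    have hblk : Measurable fun ω => fun (i : Fin m) => y ⟨(r : ℕ) * m + i, mul_add_lt hRm r i⟩ ω :=
      measurable_pi_lambda _ fun i => hym _
    exact hg.comp hblk
  have h := measureReal_half_far_le (μ := P) (univ : Finset (Fin R)) hYind hYm
    (∫ a, ∫ b, min (p a * q b) (p b * q a) ∂μ ∂μ) ((t + u) / (1 - u)) hfar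
  simpa only [card_univ, Fintype.card_fin] using h

/-- **THE PRINTED ACCEPTANCE RATIO WITH NO SECOND WEIGHT MOMENT, A-PRIORI RADII, FOR ANY SAMPLE
MEDIAN** `med(ω)` of the `R` printed block ratios: `8/(m − 1) ≤ t²`, `40A₁ ≤ m^ε u^{1+ε}`,
`0 < u < 1` ⇒ `P( (t + u)/(1 − u) ≤ |med − acc(p, q)| ) ≤ exp(−R/8)` — a `(1 + ε)`-th weight
moment is the only analytic input. [ours] -/
theorem printedAcceptance_sampleMedian_confidence_heavyTail {y : Fin n → Ω → X}
    (hym : ∀ j, Measurable (y j)) (hind : iIndepFun y P) {p q : X → ℝ} (hp0 : ∀ z, 0 ≤ p z)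
    (hpm : Measurable p) (hpi : Integrable p μ) (hp1 : ∫ z, p z ∂μ = 1) (hq0 : ∀ z, 0 < q z)
    (hqm : Measurable q) (hqi : Integrable q μ) (hε0 : 0 < ε) (hε1 : ε ≤ 1)
    (hA1i : Integrable (fun z => p z ^ (1 + ε) / q z ^ ε) μ)
    (hlaw : ∀ j, Measure.map (y j) P = μ.withDensity fun z => ENNReal.ofReal (q z))
    {wt : X → ℝ} {c : ℝ} (hc : 0 < c) (hwt : ∀ z, wt z = c * (p z / q z))
    (hm : 2 ≤ m) (hRm : R * m ≤ n) {t u : ℝ} (ht : 0 < t) (hu : 0 < u) (hu1 : u < 1)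
    (hmt : 8 / (m - 1 : ℝ) ≤ t ^ 2)
    (hvu : 40 * ∫ z, p z ^ (1 + ε) / q z ^ ε ∂μ ≤ (m : ℝ) ^ ε * u ^ (1 + ε)) {med : Ω → ℝ}
    (hlo : ∀ ω, (R : ℝ) / 2 ≤ #{r ∈ (univ : Finset (Fin R)) | med ω ≤
        ((∑ z ∈ (univ : Finset (Fin m)).offDiag,
              min (wt (y ⟨((r : Fin R) : ℕ) * m + z.1, mul_add_lt hRm r z.1⟩ ω))
                (wt (y ⟨((r : Fin R) : ℕ) * m + z.2, mul_add_lt hRm r z.2⟩ ω)))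
              / (m * (m - 1) : ℝ))
            / ((∑ j : Fin m, wt (y ⟨((r : Fin R) : ℕ) * m + j, mul_add_lt hRm r j⟩ ω)) / m)})
    (hhi : ∀ ω, (R : ℝ) / 2 ≤ #{r ∈ (univ : Finset (Fin R)) |
        ((∑ z ∈ (univ : Finset (Fin m)).offDiag,
              min (wt (y ⟨((r : Fin R) : ℕ) * m + z.1, mul_add_lt hRm r z.1⟩ ω))
                (wt (y ⟨((r : Fin R) : ℕ) * m + z.2, mul_add_lt hRm r z.2⟩ ω)))
              / (m * (m - 1) : ℝ))
            / ((∑ j : Fin m, wt (y ⟨((r : Fin R) : ℕ) * m + j, mul_add_lt hRm r j⟩ ω)) / m)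
          ≤ med ω}) :
    P.real {ω | (t + u) / (1 - u) ≤ |med ω - ∫ a, ∫ b, min (p a * q b) (p b * q a) ∂μ ∂μ|}
      ≤ exp (-(R / 8)) := by
  have hvt : 8 * ((2 * (1 - (∫ a, ∫ b, min (p a * q b) (p b * q a) ∂μ ∂μ) ^ 2)
        + 4 * (m - 2) * ((∫ a, ∫ b, min (p a * q b) (p b * q a) ∂μ ∂μ)
          - (∫ a, ∫ b, min (p a * q b) (p b * q a) ∂μ ∂μ) ^ 2)) / (m * (m - 1))) ≤ t ^ 2 := by
    refine ((mul_le_mul_of_nonneg_left (acceptanceEnvelope_le_inv hm) (by norm_num)).trans ?_)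
    rw [mul_one_div]
    exact hmt
  refine (measureReal_mono ?_).trans
    (printedAcceptance_medianOfBlocks_confidence_heavyTail hym hind hp0 hpm hpi hp1 hq0 hqm hqi
      hε0 hε1 hA1i hlaw hc hwt hm hRm ht hu hu1 hvt hvu)
  intro ω hω
  simp only [Set.mem_setOf_eq] at hω ⊢
  by_contra hlt
  push Not at hlt
  have hR : (#(univ : Finset (Fin R)) : ℝ) = R := by rw [card_univ, Fintype.card_fin]
  have h := abs_median_sub_lt_of_card_lt (univ : Finset (Fin R)) _ (hR ▸ hlo ω) (hR ▸ hhi ω)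
    (hR ▸ hlt)
  linarith

end Certificate

end Summit.Ventures.LatticeQCDFlow.Scoring.AllPairsMedian

end
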